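import Literature.MathematicalPhysics.QuantumFieldTheory.Balaban1983to89.B15Prop1Carrier

/-!
# `Balaban1983to89.B15Prop1CarrierDomain` — T. Bałaban, *Large field renormalization. I. The basic step of the 𝐑 operation*,
Commun. Math. Phys. **122** (1989) 175–202 [Balaban1989LargeFieldI] («[IV]»), **Proposition 1** p. 194 and the DOMAIN SENTENCE
of (1.77): *«Consider the function V_k↾_Λ → A(U_{k,Z}(V_k)). (1.77) It is defined on configurations V_k satisfying mild
regularity conditions, e.g., |∂V_k − 1| < a₁ on Z.»* — a LOCATED TYPING OBSERVATION, kernel-checked, on the freshly landed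
carrier of print `B15Prop1Carrier.lfVar` (p454717): its orbit type is the WHOLE orbit space `OrbitSp G Λ^{(k)}` and its function
`f` is total, so the uniqueness clause *«there exists exactly one critical orbit»* of `B15.Prop1Printed (lfVar ch I)` quantifies
over ALL Λ-orbits in the variables — and is then REFUTED by a second critical orbit whenever one exists; in particular by the
MAXIMUM orbit of a continuous, chart-differentiable, gauge-invariant function (1.77) on a compact group that is not constant on
the variables (Fermat, exactly as the carrier's own `IsMinPt.isCriticalPt` for the minimum).  Print's uniqueness is among the
orbits of the DOMAIN of (1.77) (the regular configurations, where [Balaban1989LargeFieldII] p. 359's contraction argument runs: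
*«where V′ satisfies mild regularity conditions. Fixing the gauge G₀ for V′ we get a small configuration»*); the located
repair is to restrict the carrier's orbits (or its criticality predicate) to that domain — e.g. `orbitDev (plaqsOf Λ^{(k)}) O < a₁`
— as n12-b's dictionary (HONEST SCOPE (ii) of `B15Prop1FromModel`) and n12-c's model carrier (`B15Prop1ModelCarrier.lfVarOfModel`:
orbits = the chart) already do.  REPAIR OF RECORD (independent of this flag, landed 16:35Z the same hour): the typist's v1.1
`B15Prop1Carrier.lfVarOn` (p456691) — criticality and minimality restricted to `extSet ∩ dom`, `dom` the domain of (1.77)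
(`InstOn.dom`; print's instance `domReg Z k a₁`).  §4 below records what that repair must still avoid: a `dom` containing two
critical Λ-orbits (e.g. `a₁` so large that the maximum orbit is «regular») is refuted by the same mechanism.  Nothing of
`B15Prop1Carrier` is modified here.

statement-level skeleton of published theorems with citation tags; proofs where landed; nothing here is a claim about
the Yang–Mills mass gap

Cell pub-ymgap, HUMAN RULING D-0062 (Track A full width), seat `pub-ymgap-dag-n12-c` (R134 acceleration seat (a), strategy s1 of
DAG node N12 = [B15]: «INHABIT `B15.Prop1Printed`»).  Why this matters for N12: a pin `ResidW.LF := fun P => lfVar ch (I P)` with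
print's instance `Inst.std` (the Wilson action of the background, continuous and smooth on the compact `SU(N)^{bonds}`) would make
the display `hP1 : Prop1Printed (λ.LF P)` UNPROVABLE as typed (two critical orbits: the minimum and the maximum), i.e. N12's `p1`
conjunct would be refutable at the objects of record — a located, repairable typing-strength flag (TS species), count-neutral.
PDFs held: `paper:balaban1989-cmp122-large-field-i` (journal page = PDF page + 174; p. 194 = PDF 20, text layer re-read by this
seat 2026-08-26), `paper:balaban1989-cmp122-large-field-ii` (p. 359 = PDF 5).

WHAT THIS FILE PROVES (theorems only; Mathlib + `B15Prop1Carrier`; no `sorry`, no definition, no `… : Prop` fact; axioms standard).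
§1 `isCriticalPt_of_isMaxOn` — Fermat for a MAXIMUM over the variables: a configuration maximising `f` on `extSet Λb V_k` whose
   chart variations are differentiable at `0` is a critical configuration (`IsCriticalPt`) — the mirror of the carrier's
   `IsMinPt.isCriticalPt`.
§2 **`not_prop1Printed_lfVar_of_two_critical`** — if at some instance `i`, below every threshold there are a regular datum `V_k`
   and TWO critical configurations in the variables at `V_k` on DIFFERENT Λ-orbits, then `¬ B15.Prop1Printed (lfVar ch I)` (the
   uniqueness clause over the whole orbit space fails).  **`not_prop1Printed_lfVar_of_min_max`** — the same from a minimum and a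
   maximum on different orbits with differentiable chart variations.
§3 **`not_prop1Printed_lfVar_of_compact`** — for `G` a compact Hausdorff topological group-carrier: if at some instance the
   function (1.77) is continuous (product topology on the bond variables), has differentiable chart variations, is invariant
   under the gauge transformations defined on `Λ^{(k)}`, and below every threshold some regular datum has the function NOT
   constant on its variables, then `¬ B15.Prop1Printed (lfVar ch I)` (compactness gives a minimum and a maximum on the variables;
   non-constancy separates their orbits by invariance).
§4 **`not_prop1Printed_lfVarOn_of_two_critical`** — the reading of record `lfVarOn`: two critical configurations on different
   Λ-orbits whose orbits lie INSIDE `extSet ∩ dom` below every threshold still refute `B15.Prop1Printed (lfVarOn ch I)` — the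
   domain must exclude the second critical orbit (print: `a₁` small, the maximum of the Wilson action is a LARGE field).

HONEST SCOPE.  (i) Nothing is asserted about print's instance `Inst.std`: continuity ∕ differentiability ∕ non-constancy of
`A(U_{k,Z}(·))` there are hypotheses of §3, not discharged (r12's `DetBackground` is abstract); the theorems say what ANY pin of
`LF` by `lfVar` must avoid.  (ii) No repair is typed here (the carrier is the typist's; the restricted-orbit variant is one
`Subtype` away).  (iii) The p. 359 model side is consistent: `B15Prop1FromModel.critical_unique_of_chart` is uniqueness ON THE
CHART.  Count-neutral; NOT summit progress.
-/

noncomputable section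

open Set

namespace Literature.MathematicalPhysics.QuantumFieldTheory.Balaban1983to89.B15Prop1CarrierDomain

open Literature.MathematicalPhysics.QuantumFieldTheory.Balaban1983to89
open B15DeterminingSets GaugeField B16Sect1Backgrounds B15Prop1Carrier

variable {P : Params}

/-! ## §1 Fermat for a maximum over the variables -/

section Fermat

variable {G : Type*} [GaugeGroup G] {𝔤 : Type*} [AddCommGroup 𝔤] [Module ℝ 𝔤] (ch : ExpChart G 𝔤) {k : ℕ}

/-- **A maximum over the variables is critical** (Fermat): if `V ∈ extSet Λb V_k` maximises `f` there and its chart variations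
`s ↦ f((exp isA)·V)`, `A` supported on `Λb`, are differentiable at `0`, then `V` is a critical configuration — the variations
stay among the variables (`expMul_smul_mem_extSet`), so `s = 0` is a local maximum of each.  Mirror of the carrier's
`IsMinPt.isCriticalPt`. [cite: Balaban1989LargeFieldI, Prop. 1 (1.77) p.194; Balaban1989LargeFieldII, (1.12) p.359] -/
theorem isCriticalPt_of_isMaxOn {Λb : Set (PBond P k)} {f : GaugeField P k G → ℝ} {Vk V : GaugeField P k G}
    (hV : V ∈ extSet Λb Vk) (hmax : ∀ W ∈ extSet Λb Vk, f W ≤ f V)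
    (hd : ∀ A : VecField P k 𝔤, IsSupportedOn Λb A → DifferentiableAt ℝ (fun s : ℝ => f (expMul ch (s • A) V)) 0) :
    IsCriticalPt ch Λb f V := by
  intro A hA
  have hmx : IsLocalMax (fun s : ℝ => f (expMul ch (s • A) V)) 0 := by
    refine Filter.Eventually.of_forall fun s => ?_
    show f (expMul ch (s • A) V) ≤ f (expMul ch ((0 : ℝ) • A) V)
    rw [expMul_zero_smul]
    exact hmax _ (expMul_smul_mem_extSet ch hA hV s)
  have hderiv := (hd A hA).hasDerivAt
  rwa [hmx.deriv_eq_zero] at hderiv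

end Fermat

/-! ## §2 Two critical orbits refute the uniqueness clause of `Prop1Printed (lfVar ch I)` -/

section TwoCritical

variable {G : Type} [GaugeGroup G] {𝔤 : Type*} [AddCommGroup 𝔤] [Module ℝ 𝔤] (ch : ExpChart G 𝔤)

/-- **Two critical configurations on different Λ-orbits kill `Prop1Printed (lfVar ch I)`.**  If at the instance `i`, below EVERY
threshold `e0 > 0` there are an `ε ∈ (0, e0]`, a datum `V_k` regular on `Z ∩ Λᶜ`, and two critical configurations of the function
(1.77) in the variables at `V_k` lying on different orbits of the gauge transformations defined on `Λ^{(k)}`, then the typed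
Proposition 1 at print's carrier FAILS: its clause *«there exists exactly one critical orbit»* quantifies over the WHOLE orbit
space, and both orbits qualify (`orbit_subset_extSet`).  Print's uniqueness is among the orbits of the domain of (1.77) (*«It is
defined on configurations V_k satisfying mild regularity conditions, e.g., |∂V_k − 1| < a₁ on Z»*). [cite: Balaban1989LargeFieldI,
Prop. 1 (1.77) p.194 (domain sentence; bookkeeping on the typed uniqueness clause)] -/
theorem not_prop1Printed_lfVar_of_two_critical {ι : Type} (I : ι → Inst P G) (i : ι)
    (h : ∀ e0 : ℝ, 0 < e0 → ∃ ε : ℝ, 0 < ε ∧ ε ≤ e0 ∧ ∃ Vk : GaugeField P (I i).k G,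
      PlaqSmallOn (plaqsInside (pts (I i).k ((I i).Z ∩ ((I i).Λ)ᶜ))) ε Vk ∧
      ∃ V₁ V₂ : GaugeField P (I i).k G,
        V₁ ∈ extSet (bondsOf (pts (I i).k (I i).Λ)) Vk ∧ V₂ ∈ extSet (bondsOf (pts (I i).k (I i).Λ)) Vk ∧
        IsCriticalPt ch (bondsOf (pts (I i).k (I i).Λ)) (I i).f V₁ ∧
        IsCriticalPt ch (bondsOf (pts (I i).k (I i).Λ)) (I i).f V₂ ∧
        V₂ ∉ orbit (pts (I i).k (I i).Λ) V₁) :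
    ¬ B15.Prop1Printed (lfVar ch I) := by
  intro hP
  obtain ⟨B₅, -, hall⟩ := (prop1Printed_lfVar_iff ch I).1 hP
  obtain ⟨e0, he0, hε⟩ := hall i
  obtain ⟨ε, hε0, hεle, Vk, hreg, V₁, V₂, h₁, h₂, hc₁, hc₂, hne⟩ := h e0 he0
  obtain ⟨O, -, huniq, -, -, -⟩ := hε ε hε0 hεle Vk hreg
  have hO₁ : orbitOf (pts (I i).k (I i).Λ) V₁ = O :=
    huniq _ ⟨orbit_subset_extSet h₁, V₁, mem_orbitOf_self _ _, hc₁⟩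
  have hO₂ : orbitOf (pts (I i).k (I i).Λ) V₂ = O :=
    huniq _ ⟨orbit_subset_extSet h₂, V₂, mem_orbitOf_self _ _, hc₂⟩
  exact hne (orbitOf_eq_orbitOf_iff.1 (hO₂.trans hO₁.symm))

/-- **A minimum and a maximum on different orbits kill `Prop1Printed (lfVar ch I)`**: both are critical (the carrier's
`IsMinPt.isCriticalPt` and `isCriticalPt_of_isMaxOn`, under differentiability of their chart variations), so
`not_prop1Printed_lfVar_of_two_critical` applies. [cite: Balaban1989LargeFieldI, Prop. 1 (1.77) p.194 (domain sentence;
bookkeeping on the typed uniqueness clause)] -/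
theorem not_prop1Printed_lfVar_of_min_max {ι : Type} (I : ι → Inst P G) (i : ι)
    (h : ∀ e0 : ℝ, 0 < e0 → ∃ ε : ℝ, 0 < ε ∧ ε ≤ e0 ∧ ∃ Vk : GaugeField P (I i).k G,
      PlaqSmallOn (plaqsInside (pts (I i).k ((I i).Z ∩ ((I i).Λ)ᶜ))) ε Vk ∧
      ∃ Vmin Vmax : GaugeField P (I i).k G,
        IsMinPt (bondsOf (pts (I i).k (I i).Λ)) (I i).f Vk Vmin ∧
        (Vmax ∈ extSet (bondsOf (pts (I i).k (I i).Λ)) Vk ∧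
          ∀ W ∈ extSet (bondsOf (pts (I i).k (I i).Λ)) Vk, (I i).f W ≤ (I i).f Vmax) ∧
        (∀ A : VecField P (I i).k 𝔤, IsSupportedOn (bondsOf (pts (I i).k (I i).Λ)) A →
          DifferentiableAt ℝ (fun s : ℝ => (I i).f (expMul ch (s • A) Vmin)) 0) ∧
        (∀ A : VecField P (I i).k 𝔤, IsSupportedOn (bondsOf (pts (I i).k (I i).Λ)) A →
          DifferentiableAt ℝ (fun s : ℝ => (I i).f (expMul ch (s • A) Vmax)) 0) ∧
        Vmax ∉ orbit (pts (I i).k (I i).Λ) Vmin) :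
    ¬ B15.Prop1Printed (lfVar ch I) := by
  refine not_prop1Printed_lfVar_of_two_critical ch I i fun e0 he0 => ?_
  obtain ⟨ε, hε0, hεle, Vk, hreg, Vmin, Vmax, hmin, ⟨hmaxS, hmax⟩, hdmin, hdmax, hne⟩ := h e0 he0
  exact ⟨ε, hε0, hεle, Vk, hreg, Vmin, Vmax, hmin.1, hmaxS, hmin.isCriticalPt ch hdmin,
    isCriticalPt_of_isMaxOn ch hmaxS hmax hdmax, hne⟩

end TwoCritical

/-! ## §3 The compact case: a continuous, chart-differentiable, invariant, non-constant function has two critical orbits -/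

section Compact

variable {G : Type} [GaugeGroup G] [TopologicalSpace G] [CompactSpace G] [T2Space G]
  {𝔤 : Type*} [AddCommGroup 𝔤] [Module ℝ 𝔤] (ch : ExpChart G 𝔤)

/-- **The compact case.**  Let `G` carry a compact Hausdorff topology.  If at the instance `i` the function (1.77) `f` is
continuous in the bond variables, its chart variations `s ↦ f((exp isA)·V)` (`A` supported on the bonds meeting `Λ^{(k)}`) are
differentiable at `0`, `f` is invariant under the gauge transformations defined on `Λ^{(k)}` (p. 194 *«The function is invariant
with respect to the group of all gauge transformations defined on Λ»*), and below every threshold `e0 > 0` some datum `V_k`,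
regular on `Z ∩ Λᶜ`, has `f` NOT CONSTANT on its variables, then `¬ B15.Prop1Printed (lfVar ch I)`: `f` attains a minimum and a
maximum on the compact set of variables, both critical, on orbits separated by the value of the invariant `f`.  So the typed
uniqueness clause over the whole orbit space is not print's (whose (1.77) *«is defined on configurations V_k satisfying mild
regularity conditions»*): any pin of `ResidW.LF` by `lfVar` at a smooth compact-group instance must first restrict the orbits
to that domain. [cite: Balaban1989LargeFieldI, Prop. 1 (1.77) p.194 (domain and invariance sentences; bookkeeping on the typed
uniqueness clause)] -/
theorem not_prop1Printed_lfVar_of_compact {ι : Type} (I : ι → Inst P G) (i : ι)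
    (hcont : Continuous fun V : PBond P (I i).k → G => (I i).f V)
    (hd : ∀ (V : GaugeField P (I i).k G) (A : VecField P (I i).k 𝔤), IsSupportedOn (bondsOf (pts (I i).k (I i).Λ)) A →
      DifferentiableAt ℝ (fun s : ℝ => (I i).f (expMul ch (s • A) V)) 0)
    (hinv : ∀ u : GaugeTransf P (I i).k G, IsGaugeOn (pts (I i).k (I i).Λ) u → ∀ V, (I i).f (gaugeAct u V) = (I i).f V)
    (hnc : ∀ e0 : ℝ, 0 < e0 → ∃ ε : ℝ, 0 < ε ∧ ε ≤ e0 ∧ ∃ Vk : GaugeField P (I i).k G,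
      PlaqSmallOn (plaqsInside (pts (I i).k ((I i).Z ∩ ((I i).Λ)ᶜ))) ε Vk ∧
      ∃ W W' : GaugeField P (I i).k G, W ∈ extSet (bondsOf (pts (I i).k (I i).Λ)) Vk ∧
        W' ∈ extSet (bondsOf (pts (I i).k (I i).Λ)) Vk ∧ (I i).f W ≠ (I i).f W') :
    ¬ B15.Prop1Printed (lfVar ch I) := by
  -- the product topology on the bond variables `GaugeField P k G = (PBond P k → G)` (local, no instance declared)
  letI : TopologicalSpace (GaugeField P (I i).k G) := Pi.topologicalSpace
  haveI : CompactSpace (GaugeField P (I i).k G) := Pi.compactSpace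
  have hcont' : Continuous (I i).f := hcont
  refine not_prop1Printed_lfVar_of_min_max ch I i fun e0 he0 => ?_
  obtain ⟨ε, hε0, hεle, Vk, hreg, W, W', hW, hW', hWW⟩ := hnc e0 he0
  set Λb := bondsOf (pts (I i).k (I i).Λ) with hΛb
  -- the variables at `V_k` form a closed, hence compact, nonempty set
  have hS : IsCompact (extSet Λb Vk) := by
    have e : extSet Λb Vk = ⋂ b, ⋂ (_ : b ∉ Λb), {V : GaugeField P (I i).k G | V b = Vk b} := by
      ext V
      simp only [mem_extSet_iff, mem_iInter, mem_setOf_eq]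
    have hclosed : IsClosed (extSet Λb Vk) := by
      rw [e]
      exact isClosed_iInter fun b => isClosed_iInter fun _ =>
        isClosed_eq (continuous_apply (A := fun _ : PBond P (I i).k => G) b) continuous_const
    exact hclosed.isCompact
  have hne : (extSet Λb Vk).Nonempty := ⟨Vk, mem_extSet_self Λb Vk⟩
  obtain ⟨Vmin, hminS, hmin⟩ := hS.exists_isMinOn hne hcont'.continuousOn
  obtain ⟨Vmax, hmaxS, hmax⟩ := hS.exists_isMaxOn hne hcont'.continuousOn
  rw [isMinOn_iff] at hmin
  rw [isMaxOn_iff] at hmax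
  refine ⟨ε, hε0, hεle, Vk, hreg, Vmin, Vmax, ⟨hminS, fun V hV => hmin V hV⟩, ⟨hmaxS, fun V hV => hmax V hV⟩,
    hd Vmin, hd Vmax, fun horb => ?_⟩
  -- on one orbit the invariant `f` takes one value, so `f` would be constant on the variables
  obtain ⟨u, hu, hVmax⟩ := horb
  have hval : (I i).f Vmax = (I i).f Vmin := by rw [hVmax]; exact hinv u hu Vmin
  have hconst : ∀ V ∈ extSet Λb Vk, (I i).f V = (I i).f Vmin := fun V hV =>
    le_antisymm ((hmax V hV).trans hval.le) (hmin V hV)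
  exact hWW ((hconst W hW).trans (hconst W' hW').symm)

end Compact

/-! ## §4 The reading of record `lfVarOn`: the domain must separate the critical orbits -/

section OnDomain

variable {G : Type} [GaugeGroup G] {𝔤 : Type*} [AddCommGroup 𝔤] [Module ℝ 𝔤] (ch : ExpChart G 𝔤)

/-- **The same test for the carrier of record `lfVarOn`** (the typist's v1.1, criticality restricted to `extSet ∩ dom`): if at the
instance `i`, below every threshold there are a regular datum `V_k` and two critical configurations on different Λ-orbits whose
ORBITS LIE INSIDE `extSet V_k ∩ dom`, then `¬ B15.Prop1Printed (lfVarOn ch I)`.  So the repair works exactly when `dom` — print's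
*«|∂V_k − 1| < a₁ on Z»* with `a₁` SMALL — excludes the second critical orbit (the maximum of the Wilson action is a large field);
with `dom = univ` (or `a₁` huge) the typed uniqueness clause is again not print's. [cite: Balaban1989LargeFieldI, Prop. 1 (1.77)
p.194 (domain sentence; bookkeeping on the typed uniqueness clause)] -/
theorem not_prop1Printed_lfVarOn_of_two_critical {ι : Type} (I : ι → InstOn P G) (i : ι)
    (h : ∀ e0 : ℝ, 0 < e0 → ∃ ε : ℝ, 0 < ε ∧ ε ≤ e0 ∧ ∃ Vk : GaugeField P (I i).k G,
      PlaqSmallOn (plaqsInside (pts (I i).k ((I i).Z ∩ ((I i).Λ)ᶜ))) ε Vk ∧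
      ∃ V₁ V₂ : GaugeField P (I i).k G,
        orbit (pts (I i).k (I i).Λ) V₁ ⊆ extSet (bondsOf (pts (I i).k (I i).Λ)) Vk ∩ (I i).dom ∧
        orbit (pts (I i).k (I i).Λ) V₂ ⊆ extSet (bondsOf (pts (I i).k (I i).Λ)) Vk ∩ (I i).dom ∧
        IsCriticalPt ch (bondsOf (pts (I i).k (I i).Λ)) (I i).f V₁ ∧
        IsCriticalPt ch (bondsOf (pts (I i).k (I i).Λ)) (I i).f V₂ ∧
        V₂ ∉ orbit (pts (I i).k (I i).Λ) V₁) :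
    ¬ B15.Prop1Printed (lfVarOn ch I) := by
  intro hP
  obtain ⟨B₅, -, hall⟩ := (prop1Printed_lfVarOn_iff ch I).1 hP
  obtain ⟨e0, he0, hε⟩ := hall i
  obtain ⟨ε, hε0, hεle, Vk, hreg, V₁, V₂, h₁, h₂, hc₁, hc₂, hne⟩ := h e0 he0
  obtain ⟨O, -, huniq, -, -, -⟩ := hε ε hε0 hεle Vk hreg
  have hO₁ : orbitOf (pts (I i).k (I i).Λ) V₁ = O := huniq _ ⟨h₁, V₁, mem_orbitOf_self _ _, hc₁⟩
  have hO₂ : orbitOf (pts (I i).k (I i).Λ) V₂ = O := huniq _ ⟨h₂, V₂, mem_orbitOf_self _ _, hc₂⟩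
  exact hne (orbitOf_eq_orbitOf_iff.1 (hO₂.trans hO₁.symm))

end OnDomain

end Literature.MathematicalPhysics.QuantumFieldTheory.Balaban1983to89.B15Prop1CarrierDomain

end
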